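import Literature.Analysis.FluidPDE.KwonLocalLerayDuality
import Literature.Analysis.FluidPDE.KwonTestFieldCalculus
import Literature.Analysis.FluidPDE.ClassicalLerayProjection
import HarnessLib

/-!
# Kwon's Lemma 2.5: the convective term on the test side — harmonic-part, shell and
# self-interaction pieces

Analysis/FluidPDE file on the discharge path of the named fact
`Literature.Analysis.FluidPDE.kwon2023_velocity_epsilon_regularity`
(`PressureFreeEpsilonRegularity.lean`; H. Kwon, J. Differential Equations (2023) =
arXiv:2104.03160, Thm. 1.4), seventh brick of Lemma 2.5 (proof, arXiv p. 8: the paragraph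
"the convection term can be decomposed by `u ⊗ u : ∇ζ = ∇(u ⊗ u φ) : ∇²Δ⁻¹ curl ξ` …").
Testing Navier–Stokes with `Z = ζ_{ξ(t,·)}`, the convective pairing of a slice `U` is
`⟪U, (U·∇)ζ_ξ⟫ = Σᵢ ⟪UᵢU, ∂ᵢζ_ξ⟫` (`inner_clm_apply_eq_sum`), and
`∂ᵢζ_ξ = ζ_{∂ᵢξ} − curl((∂ᵢφ) curl A_ξ)` (`KwonTestFieldCalculus`; the commutator is handled in
`KwonCommutatorFields`). The duality identity of `KwonLocalLerayDuality` applied to the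
`L¹` densities `w = UᵢU` and the test fields `∂ᵢξ` leaves three kinds of terms, all put here in
the form `∫ (pressure) div ξ + ∫ ⟪force, ξ⟫` with **explicit** fields built from the slice:

* **(N2)** `integral_inner_harmonicPart_fderiv_apply`: for `w ∈ L¹(B₂)`,
  `∫ ⟪H w, ∂ₐξ⟫ = ∫ ((∂ₐk) ⋆ (w·∇φ)) div ξ + ∫ ⟪curl((∂ₐk) ⋆ (∇φ × w)), ξ⟫` (derivative moved
  onto the annular kernel `k`; the force is a curl, hence divergence free);
* **(N3)** `sum_integral_inner_gradient_cutoff_mul_divergence`: for `U ∈ L²`,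
  `Σᵢ ∫ Uᵢ⟪U, ∇(φ div A_{∂ᵢξ})⟫ = ∫ P_{(U·∇φ)U} div ξ + ∫ φ D²(div A_ξ)(U, U)` with the
  **shell pressure** `P_g(y) = ∫ ⟪g(x), ∇k(x − y)⟫ dx` (`shellPressure`; `|P_g| ≤ ‖∇k‖_∞‖g‖₁`,
  continuous) — by the pointwise identity `Σᵢ vᵢ⟪v, ∇(φ∂ᵢΠ)⟫ = ⟪v,∇φ⟫⟪v,∇Π⟫ + φ D²Π(v,v)`
  (`sum_mul_inner_gradient_cutoff_mul`), `div A_{∂ᵢξ} = ∂ᵢ div A_ξ`, and the transposition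
  `∫ ⟪g, ∇ div A_ξ⟫ = ∫ P_g div ξ` for shell-supported `g`
  (`integral_inner_gradient_divergence_testPotential`: kernel swap `A_ξ = k ⋆ ξ` near the shell,
  derivative on the kernel, Fubini). The remaining Calderón–Zygmund term `∫ φ U⊗U : ∇²Δ⁻¹div ξ`
  is the one carried by the `L^{3/2}` Riesz pressure (next brick);
* **(hh)** `integral_inner_harmonicPart_convect`: for `ξ` supported in `B₁`,
  `∫ ⟪h, (h·∇)ξ⟫ = ∫ π[F] div ξ − ∫ ⟪P[F], ξ⟫`, `h = H U`, `F = φ♭ (h·∇)h` (`selfStretch`, with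
  Kwon's inner cut-off `φ♭ = θ_{1,9/8}`, `kwonFlatCutoff`), `P`/`π` the classical Leray
  projection / divergence potential of the test field `F` (`ClassicalLerayProjection`): `div h = 0`
  on `B₁` moves `(h·∇)` onto `h`, and `F = P[F] + ∇π[F]`.

Also: the vector integration by parts `∫ ⟪Ψ, ∂ₐξ⟫ = −∫ ⟪∂ₐΨ, ξ⟫`, coordinate expansions, and
integrability of the `|U|²`-weighted pairings.

## Mathlib / tree search

Tree (reused): `harmonicPart`, `scalarDensity`, `vectorDensity`, `integrable_scalar/vectorDensity`,
`contDiff_potential_scalar/vector`, `fderiv_potential_scalar/vector_eq`,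
`divergence_harmonicPart_eq_zero`, `contDiff_harmonicPart`, `exists_bound_gradient_kwonCutoff`
(`KwonHarmonicPart`); `testPotential_eventuallyEq`, `fderiv_testPotential_apply'`,
`contDiff_testPotential_nat` (`KwonTestField(Calculus)`); `divergence_convolution_lsmul`,
`contDiff_divergence_testPotential`, `hasCompactSupport_divergence_testPotential`,
`integrable_inner_density`, `exists_bound_gradient_annularKernel`,
`hasCompactSupport_of_tsupport_subset_closedBall` (`KwonLocalLerayDuality`);
`integral_inner_gradient_eq_neg_integral_mul_divergence`, `integral_inner_convect_add_eq_zero`,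
`integral_fderiv_apply_eq_zero` (`WholeSpaceIBP`); `integral_mul_fderiv_apply_eq_neg`
(`HessianLaplacian`); `divergence_fderiv_apply`, `curl_fderiv_apply`
(`TaoEnstrophyLocalisationProofs`); `ConvolutionLaplacian.fderiv_convolution_left_apply`;
`classicalLerayProj`, `divPotential`, `classicalLerayProj_add_gradient`, `contDiff_divPotential`,
`contDiff_classicalLerayProj` (`ClassicalLerayProjection`); `radialCutoff*` (`NewtonKernel`).
Mathlib: `integral_integral_swap`, `Integrable.mul_prod`, `continuous_of_dominated`,
`convolution_lsmul_swap`, `fderiv_clm_apply`, `OrthonormalBasis.sum_repr`.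

## References

* H. Kwon, J. Differential Equations (2023) = arXiv:2104.03160: proof of Lemma 2.5 (arXiv p. 8),
  Remark 2.2–2.3. [Kwon2023RolePressure]
* A. J. Majda, A. L. Bertozzi, *Vorticity and Incompressible Flow* (2002), §1.8 Prop. 1.16
  (Hodge decomposition in `ℝᴺ`). [MajdaBertozziCUP2002]
-/

noncomputable section

open MeasureTheory Set Function Filter Topology TopologicalSpace Metric InnerProductSpace
  ContinuousLinearMap
open scoped NNReal ENNReal RealInnerProductSpace Convolution Laplacian ContDiff

namespace Literature.Analysis.FluidPDE

namespace Kwon2023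

/-! ### Supports of inner-product pairings -/

/-- `supp ⟪Ψ, ξ⟫ ⊆ supp ξ`. [folklore] -/
theorem support_inner_subset_right {Ψ ξ : EuclideanSpace ℝ (Fin 3) → EuclideanSpace ℝ (Fin 3)} :
    support (fun x => ⟪Ψ x, ξ x⟫) ⊆ support ξ := fun x hx => by
  contrapose! hx
  simp only [mem_support, not_not] at hx ⊢
  rw [hx, inner_zero_right]

/-- `supp ⟪Ψ, ξ⟫ ⊆ supp Ψ`. [folklore] -/
theorem support_inner_subset_left {Ψ ξ : EuclideanSpace ℝ (Fin 3) → EuclideanSpace ℝ (Fin 3)} :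
    support (fun x => ⟪Ψ x, ξ x⟫) ⊆ support Ψ := fun x hx => by
  contrapose! hx
  simp only [mem_support, not_not] at hx ⊢
  rw [hx, inner_zero_left]

/-- The divergence of a `Cⁿ⁺¹` field is `Cⁿ`. [folklore] -/
theorem contDiff_divergence_succ {ξ : EuclideanSpace ℝ (Fin 3) → EuclideanSpace ℝ (Fin 3)} {n : ℕ∞}
    (hξ : ContDiff ℝ (n + 1) ξ) : ContDiff ℝ n (VectorCalculus.divergence ξ) := by
  rw [divergence_eq_traceCLM_comp]
  exact traceCLM.contDiff.comp (hξ.fderiv_right (m := n) le_rfl)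

/-- The divergence of a compactly supported field has compact support. [folklore] -/
theorem hasCompactSupport_divergence_of {ξ : EuclideanSpace ℝ (Fin 3) → EuclideanSpace ℝ (Fin 3)}
    (hξc : HasCompactSupport ξ) : HasCompactSupport (VectorCalculus.divergence ξ) := by
  rw [divergence_eq_traceCLM_comp]
  exact (hξc.fderiv (𝕜 := ℝ)).comp_left (map_zero _)

/-! ### One integration by parts for vector fields -/

/-- `∫ ⟪Ψ, ∂ₐξ⟫ = -∫ ⟪∂ₐΨ, ξ⟫` for `Ψ ∈ C¹`, `ξ ∈ C¹_c`. [folklore] -/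
theorem integral_inner_fderiv_apply_eq_neg_left
    {Ψ ξ : EuclideanSpace ℝ (Fin 3) → EuclideanSpace ℝ (Fin 3)} (hΨ : ContDiff ℝ 1 Ψ)
    (hξ : ContDiff ℝ 1 ξ) (hξc : HasCompactSupport ξ) (a : EuclideanSpace ℝ (Fin 3)) :
    ∫ x, ⟪Ψ x, fderiv ℝ ξ x a⟫ = -∫ x, ⟪fderiv ℝ Ψ x a, ξ x⟫ := by
  have hprod : ContDiff ℝ 1 fun x => ⟪Ψ x, ξ x⟫ := hΨ.inner ℝ hξ
  have hpc : HasCompactSupport fun x => ⟪Ψ x, ξ x⟫ := hξc.mono support_inner_subset_right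
  have h0 := integral_fderiv_apply_eq_zero hprod hpc a
  have hpt : ∀ x, fderiv ℝ (fun x => ⟪Ψ x, ξ x⟫) x a =
      ⟪fderiv ℝ Ψ x a, ξ x⟫ + ⟪Ψ x, fderiv ℝ ξ x a⟫ := fun x => by
    rw [fderiv_inner_apply ℝ (hΨ.differentiable one_ne_zero x) (hξ.differentiable one_ne_zero x)]
    exact add_comm _ _
  simp_rw [hpt] at h0
  have hi1 : Integrable fun x => ⟪fderiv ℝ Ψ x a, ξ x⟫ :=
    (((hΨ.continuous_fderiv one_ne_zero).clm_apply continuous_const).inner (𝕜 := ℝ)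
      hξ.continuous).integrable_of_hasCompactSupport (hξc.mono support_inner_subset_right)
  have hi2 : Integrable fun x => ⟪Ψ x, fderiv ℝ ξ x a⟫ :=
    (hΨ.continuous.inner (𝕜 := ℝ) ((hξ.continuous_fderiv one_ne_zero).clm_apply
      continuous_const)).integrable_of_hasCompactSupport
      ((hξc.fderiv_apply (𝕜 := ℝ) a).mono support_inner_subset_right)
  rw [integral_add hi1 hi2] at h0
  linarith

/-! ### (N2) The harmonic part against a derivative of the test field -/

section HarmonicPartTranspose

variable {w ξ : EuclideanSpace ℝ (Fin 3) → EuclideanSpace ℝ (Fin 3)}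

/-- **`∫ ⟪H w, ∂ₐξ⟫ = ∫ ((∂ₐk) ⋆ (w·∇φ)) div ξ + ∫ ⟪curl((∂ₐk) ⋆ (∇φ × w)), ξ⟫`**: the harmonic
part `H w = ∇(k ⋆ (w·∇φ)) − curl(k ⋆ (∇φ × w))` of an `L¹(B₂)` field paired with a derivative of a
test field is a pressure-type term plus a (divergence-free, smooth) force-type term, with the
derivative moved onto the kernel (`∫ ⟪∇G, ∂ₐξ⟫ = −∫ G ∂ₐ div ξ = ∫ ∂ₐG div ξ`,
`∫ ⟪curl V, ∂ₐξ⟫ = −∫ ⟪curl ∂ₐV, ξ⟫`, `∂ₐ(k ⋆ d) = (∂ₐk) ⋆ d`). Applied to `w = uₐu` this is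
the `h`-part of Kwon's `⟨u ⊗ u : ∇ζ⟩` computation. [cite: Kwon2023RolePressure, Lemma 2.5 (proof, p. 8)] -/
theorem integral_inner_harmonicPart_fderiv_apply
    (hw : IntegrableOn w (ball (0 : EuclideanSpace ℝ (Fin 3)) 2)) (hξ : ContDiff ℝ ∞ ξ)
    (hξc : HasCompactSupport ξ) (a : EuclideanSpace ℝ (Fin 3)) :
    ∫ x, ⟪harmonicPart w x, fderiv ℝ ξ x a⟫ =
      (∫ y, ((fun z => fderiv ℝ annularKernel z a) ⋆ scalarDensity w) y *
          VectorCalculus.divergence ξ y)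
        + ∫ y, ⟪curl ((fun z => fderiv ℝ annularKernel z a) ⋆[lsmul ℝ ℝ, volume]
            vectorDensity w) y, ξ y⟫ := by
  have hd₁ : Integrable (scalarDensity w) := integrable_scalarDensity hw
  have hd₂ : Integrable (vectorDensity w) := integrable_vectorDensity hw
  set F := annularKernel ⋆ scalarDensity w with hF
  set V := annularKernel ⋆[lsmul ℝ ℝ, volume] vectorDensity w with hV
  have hFs : ContDiff ℝ 2 F := contDiff_potential_scalar hd₁.locallyIntegrable
  have hVs : ContDiff ℝ 2 V := contDiff_potential_vector hd₂.locallyIntegrable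
  have hξ1 : ContDiff ℝ 1 ξ := contDiff_infty.1 hξ 1
  have hξ2 : ContDiff ℝ 2 ξ := contDiff_infty.1 hξ 2
  have hξa : ContDiff ℝ 1 fun x => fderiv ℝ ξ x a :=
    (hξ2.fderiv_right (m := 1) le_rfl).clm_apply contDiff_const
  have hξac : HasCompactSupport fun x => fderiv ℝ ξ x a := hξc.fderiv_apply (𝕜 := ℝ) a
  have hdiv1 : ContDiff ℝ 1 (VectorCalculus.divergence ξ) := contDiff_divergence_succ hξ2
  have hdivc : HasCompactSupport (VectorCalculus.divergence ξ) := hasCompactSupport_divergence_of hξc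
  -- split the pairing
  have hiG : Integrable fun x => ⟪gradient F x, fderiv ℝ ξ x a⟫ :=
    ((continuous_gradient_of_contDiff (hFs.of_le one_le_two)).inner (𝕜 := ℝ)
      hξa.continuous).integrable_of_hasCompactSupport (hξac.mono support_inner_subset_right)
  have hiC : Integrable fun x => ⟪curl V x, fderiv ℝ ξ x a⟫ :=
    ((contDiff_curl (n := 0) (hVs.of_le one_le_two)).continuous.inner (𝕜 := ℝ)
      hξa.continuous).integrable_of_hasCompactSupport (hξac.mono support_inner_subset_right)
  have e0 : ∫ x, ⟪harmonicPart w x, fderiv ℝ ξ x a⟫ =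
      (∫ x, ⟪gradient F x, fderiv ℝ ξ x a⟫) - ∫ x, ⟪curl V x, fderiv ℝ ξ x a⟫ := by
    rw [← integral_sub hiG hiC]
    refine integral_congr_ae (Eventually.of_forall fun x => ?_)
    simp only [harmonicPart, ← hF, ← hV, inner_sub_left]
  -- the gradient term
  have e1 : ∫ x, ⟪gradient F x, fderiv ℝ ξ x a⟫ =
      ∫ y, ((fun z => fderiv ℝ annularKernel z a) ⋆ scalarDensity w) y *
        VectorCalculus.divergence ξ y := by
    rw [integral_inner_gradient_eq_neg_integral_mul_divergence (hFs.of_le one_le_two) hξa hξac]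
    have hd : ∀ y, VectorCalculus.divergence (fun x => fderiv ℝ ξ x a) y =
        fderiv ℝ (VectorCalculus.divergence ξ) y a := fun y => divergence_fderiv_apply hξ2 y a
    simp_rw [hd]
    rw [integral_mul_fderiv_apply_eq_neg (hFs.of_le one_le_two) hdiv1 hdivc a, neg_neg]
    refine integral_congr_ae (Eventually.of_forall fun y => ?_)
    dsimp only
    rw [show fderiv ℝ F y a = ((fun z => fderiv ℝ annularKernel z a) ⋆ scalarDensity w) y from
      congrFun (fderiv_potential_scalar_eq hd₁.locallyIntegrable a) y]
  -- the curl term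
  have e2 : ∫ x, ⟪curl V x, fderiv ℝ ξ x a⟫ =
      -∫ y, ⟪curl ((fun z => fderiv ℝ annularKernel z a) ⋆[lsmul ℝ ℝ, volume]
        vectorDensity w) y, ξ y⟫ := by
    rw [integral_inner_fderiv_apply_eq_neg_left (contDiff_curl (n := 1) hVs) hξ1 hξc a]
    congr 1
    refine integral_congr_ae (Eventually.of_forall fun y => ?_)
    dsimp only
    rw [← curl_fderiv_apply hVs y a, fderiv_potential_vector_eq hd₂.locallyIntegrable a]
  rw [e0, e1, e2, sub_neg_eq_add]

end HarmonicPartTranspose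

/-! ### (N3a) The shell term `(u·∇φ)⟪u, ∇ div A_ξ⟫` as a pressure -/

section ShellPressure

variable {g ξ : EuclideanSpace ℝ (Fin 3) → EuclideanSpace ℝ (Fin 3)} {r : ℝ}

/-- **The shell pressure density** of an integrable field `g` (applied to `g = (u·∇φ) u`):
`P_g(y) = ∫ ⟪g(x), ∇k(x − y)⟫ dx`, so that `∫ ⟪g, ∇ div A_ξ⟫ = ∫ P_g div ξ` (Kwon's
`Δ⁻¹ div`-type pressure term coming from `∇φ ⊗ u : ∇²Δ⁻¹ div ξ`). [cite: Kwon2023RolePressure, Lemma 2.5 (proof, p. 8)] -/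
def shellPressure (g : EuclideanSpace ℝ (Fin 3) → EuclideanSpace ℝ (Fin 3))
    (y : EuclideanSpace ℝ (Fin 3)) : ℝ :=
  ∫ x, ⟪g x, gradient annularKernel (x - y)⟫

/-- `|P_g(y)| ≤ ‖∇k‖_∞ ‖g‖_{L¹}`. [folklore] -/
theorem norm_shellPressure_le (hg : Integrable g) {K : ℝ} (hK : ∀ z, ‖gradient annularKernel z‖ ≤ K)
    (y : EuclideanSpace ℝ (Fin 3)) : ‖shellPressure g y‖ ≤ K * ∫ x, ‖g x‖ := by
  rw [shellPressure, mul_comm, ← integral_mul_const]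
  refine (norm_integral_le_integral_norm _).trans (integral_mono_of_nonneg
    (Eventually.of_forall fun x => norm_nonneg _) (hg.norm.mul_const K)
    (Eventually.of_forall fun x => ?_))
  exact (norm_inner_le_norm _ _).trans (mul_le_mul_of_nonneg_left (hK _) (norm_nonneg _))

/-- `P_g` is continuous. [folklore] -/
theorem continuous_shellPressure (hg : Integrable g) : Continuous (shellPressure g) := by
  obtain ⟨K, -, hK⟩ := exists_bound_gradient_annularKernel
  have hgk : Continuous (gradient annularKernel) :=
    FluidPDE.continuous_gradient_of_contDiff (contDiff_annularKernel (n := 1))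
  refine continuous_of_dominated (bound := fun x => ‖g x‖ * K) (fun y => ?_) (fun y => ?_)
    (hg.norm.mul_const K) (Eventually.of_forall fun x => ?_)
  · exact hg.aestronglyMeasurable.inner
      (hgk.comp (continuous_id.sub continuous_const)).aestronglyMeasurable
  · exact Eventually.of_forall fun x =>
      (norm_inner_le_norm _ _).trans (mul_le_mul_of_nonneg_left (hK _) (norm_nonneg _))
  · exact (continuous_const.inner (hgk.comp (continuous_const.sub continuous_id)))

/-- On the shell, `∇ div A_ξ = ∇(k ⋆ div ξ)` (kernel swap). [folklore] -/
theorem gradient_divergence_testPotential_eq (hξ : ContDiff ℝ ∞ ξ) (hr : r < 1)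
    (hsupp : tsupport ξ ⊆ closedBall (0 : EuclideanSpace ℝ (Fin 3)) r)
    {x : EuclideanSpace ℝ (Fin 3)} (h1 : 5 / 4 ≤ ‖x‖) (h2 : ‖x‖ ≤ 7 / 4) :
    gradient (VectorCalculus.divergence (testPotential ξ)) x =
      gradient (annularKernel ⋆ fun y => VectorCalculus.divergence ξ y) x := by
  have hev := testPotential_eventuallyEq hr hsupp h1 h2
  have hdiv : VectorCalculus.divergence (testPotential ξ) =ᶠ[𝓝 x]
      (annularKernel ⋆ fun y => VectorCalculus.divergence ξ y) :=
    hev.fderiv.mono fun z hz => by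
      rw [divergence_eq_traceCLM, hz, ← divergence_eq_traceCLM, divergence_convolution_lsmul
        (contDiff_annularKernel (n := 1)) hasCompactSupport_annularKernel (contDiff_infty.1 hξ 1) z]
  simp only [gradient, hdiv.fderiv_eq]

/-- `⟪v, ∇(k ⋆ σ)(x)⟫ = ∫ ⟪v, ∇k(x − y)⟫ σ(y) dy` for `σ ∈ C_c`. [folklore] -/
theorem inner_gradient_potential_eq {σ : EuclideanSpace ℝ (Fin 3) → ℝ} (hσ : Continuous σ)
    (x v : EuclideanSpace ℝ (Fin 3)) :
    ⟪v, gradient (annularKernel ⋆ σ) x⟫ = ∫ y, ⟪v, gradient annularKernel (x - y)⟫ * σ y := by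
  have h1 : ⟪v, gradient (annularKernel ⋆ σ) x⟫ = fderiv ℝ (annularKernel ⋆ σ) x v := by
    rw [real_inner_comm, FluidPDE.inner_gradient_left]
  have h2 : fderiv ℝ (annularKernel ⋆ σ) x v = ((fun z => fderiv ℝ annularKernel z v) ⋆ σ) x :=
    ConvolutionLaplacian.fderiv_convolution_left_apply hasCompactSupport_annularKernel
      (contDiff_annularKernel (n := 1)) hσ.locallyIntegrable x v
  have h3 : ((fun z => fderiv ℝ annularKernel z v) ⋆ σ) x =
      ∫ y, fderiv ℝ annularKernel (x - y) v * σ y := by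
    rw [convolution_lsmul_swap]
    rfl
  rw [h1, h2, h3]
  refine integral_congr_ae (Eventually.of_forall fun y => ?_)
  dsimp only
  rw [← FluidPDE.inner_gradient_left annularKernel (x - y) v, real_inner_comm]

/-- **`∫ ⟪g, ∇ div A_ξ⟫ = ∫ P_g div ξ`** for an integrable field `g` carried by the shell
`5/4 ≤ |x| ≤ 7/4` and `ξ ∈ C^∞` supported in `B̄(0, r)`, `r < 1` (kernel swap, derivative on
the kernel, Fubini). [cite: Kwon2023RolePressure, Lemma 2.5 (proof, p. 8)] -/
theorem integral_inner_gradient_divergence_testPotential (hg : Integrable g)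
    (hg0 : ∀ x : EuclideanSpace ℝ (Fin 3), ‖x‖ < 5 / 4 ∨ 7 / 4 < ‖x‖ → g x = 0)
    (hξ : ContDiff ℝ ∞ ξ) (hr : r < 1)
    (hsupp : tsupport ξ ⊆ closedBall (0 : EuclideanSpace ℝ (Fin 3)) r) :
    ∫ x, ⟪g x, gradient (VectorCalculus.divergence (testPotential ξ)) x⟫ =
      ∫ y, shellPressure g y * VectorCalculus.divergence ξ y := by
  have hξc := hasCompactSupport_of_tsupport_subset_closedBall hsupp
  set σ : EuclideanSpace ℝ (Fin 3) → ℝ := fun y => VectorCalculus.divergence ξ y with hσdef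
  have hσ : Continuous σ := (contDiff_divergence_succ (n := 0) (contDiff_infty.1 hξ 1)).continuous
  have hσc : HasCompactSupport σ := hasCompactSupport_divergence_of hξc
  obtain ⟨K, hK0, hK⟩ := exists_bound_gradient_annularKernel
  have hgk : Continuous (gradient annularKernel) :=
    FluidPDE.continuous_gradient_of_contDiff (contDiff_annularKernel (n := 1))
  -- pointwise: kernel swap and derivative on the kernel
  have hpt : ∀ x, ⟪g x, gradient (VectorCalculus.divergence (testPotential ξ)) x⟫ =
      ∫ y, ⟪g x, gradient annularKernel (x - y)⟫ * σ y := by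
    intro x
    by_cases hx : ‖x‖ < 5 / 4 ∨ 7 / 4 < ‖x‖
    · simp [hg0 x hx]
    · rw [not_or, not_lt, not_lt] at hx
      rw [gradient_divergence_testPotential_eq hξ hr hsupp hx.1 hx.2,
        inner_gradient_potential_eq hσ x (g x)]
  -- Fubini
  have hGm : AEStronglyMeasurable (fun p : EuclideanSpace ℝ (Fin 3) × EuclideanSpace ℝ (Fin 3) =>
      ⟪g p.1, gradient annularKernel (p.1 - p.2)⟫ * σ p.2) (volume.prod volume) :=
    (hg.aestronglyMeasurable.comp_fst.inner
      (hgk.comp (continuous_fst.sub continuous_snd)).aestronglyMeasurable).mul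
      (hσ.comp continuous_snd).aestronglyMeasurable
  have hGi : Integrable (fun p : EuclideanSpace ℝ (Fin 3) × EuclideanSpace ℝ (Fin 3) =>
      ⟪g p.1, gradient annularKernel (p.1 - p.2)⟫ * σ p.2) (volume.prod volume) := by
    refine Integrable.mono' ((hg.norm.mul_const K).mul_prod
      ((hσ.norm).integrable_of_hasCompactSupport hσc.norm)) hGm (Eventually.of_forall fun p => ?_)
    rw [norm_mul]
    exact mul_le_mul ((norm_inner_le_norm _ _).trans
      (mul_le_mul_of_nonneg_left (hK _) (norm_nonneg _))) le_rfl (norm_nonneg _)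
      (mul_nonneg (norm_nonneg _) hK0)
  have hGi' : Integrable (uncurry fun x y => ⟪g x, gradient annularKernel (x - y)⟫ * σ y)
      (volume.prod volume) := hGi
  rw [integral_congr_ae (Eventually.of_forall hpt), integral_integral_swap hGi']
  refine integral_congr_ae (Eventually.of_forall fun y => ?_)
  dsimp only
  rw [shellPressure, ← integral_mul_const]

end ShellPressure

/-! ### Coordinate expansions of the convective pairing -/

section Algebra

/-- `⟪v, L v⟫ = Σᵢ vᵢ ⟪v, L eᵢ⟫` (so `⟪u, (u·∇)F⟫ = Σᵢ ⟪uᵢu, ∂ᵢF⟫`). [folklore] -/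
theorem inner_clm_apply_eq_sum (L : EuclideanSpace ℝ (Fin 3) →L[ℝ] EuclideanSpace ℝ (Fin 3))
    (v : EuclideanSpace ℝ (Fin 3)) :
    ⟪v, L v⟫ = ∑ i, v i * ⟪v, L (EuclideanSpace.single (i : Fin 3) (1 : ℝ))⟫ := by
  have hv : L v = ∑ i, v i • L (EuclideanSpace.single (i : Fin 3) (1 : ℝ)) := by
    conv_lhs => rw [← (EuclideanSpace.basisFun (Fin 3) ℝ).sum_repr v]
    simp [map_sum, map_smul, EuclideanSpace.basisFun_apply]
  rw [hv, inner_sum]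
  simp only [inner_smul_right]

/-- `L v w = Σᵢ vᵢ (L eᵢ) w`-type expansion in the first slot of a bilinear map:
`(B v) v = Σᵢ vᵢ (B v) eᵢ` for `B v : ℝ³ →L ℝ`. [folklore] -/
theorem clm_apply_self_eq_sum (B : EuclideanSpace ℝ (Fin 3) →L[ℝ] ℝ) (v : EuclideanSpace ℝ (Fin 3)) :
    B v = ∑ i, v i * B (EuclideanSpace.single (i : Fin 3) (1 : ℝ)) := by
  conv_lhs => rw [← (EuclideanSpace.basisFun (Fin 3) ℝ).sum_repr v]
  simp [map_sum, map_smul, EuclideanSpace.basisFun_apply]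

/-- **Pointwise (A2)**: with `P ∈ C²`, `ψᵢ = ∂ᵢP`,
`Σᵢ vᵢ ⟪v, ∇(φ ψᵢ)⟫ = ⟪v, ∇φ⟫ ⟪v, ∇P⟫ + φ D²P(v, v)`. [folklore] -/
theorem sum_mul_inner_gradient_cutoff_mul {P : EuclideanSpace ℝ (Fin 3) → ℝ} (hP : ContDiff ℝ 2 P)
    (x v : EuclideanSpace ℝ (Fin 3)) :
    ∑ i, v i * ⟪v, gradient (fun y => kwonCutoff y *
        fderiv ℝ P y (EuclideanSpace.single (i : Fin 3) (1 : ℝ))) x⟫ =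
      ⟪v, gradient kwonCutoff x⟫ * ⟪v, gradient P x⟫ +
        kwonCutoff x * fderiv ℝ (fderiv ℝ P) x v v := by
  have hφd : DifferentiableAt ℝ kwonCutoff x :=
    (contDiff_kwonCutoff (n := 1)).differentiable one_ne_zero x
  have hψd : ∀ i, DifferentiableAt ℝ (fun y => fderiv ℝ P y (EuclideanSpace.single i (1 : ℝ))) x := fun i =>
    (((hP.fderiv_right (m := 1) le_rfl).clm_apply contDiff_const).differentiable one_ne_zero) x
  -- mixed second derivatives as entries of `D²P` (the tree's `fderiv_apply_const_apply_eq` of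
  -- `CKNPressureCZ.lean`, inlined to keep the import closure small)
  have hD2 : ∀ i, fderiv ℝ (fun y => fderiv ℝ P y (EuclideanSpace.single i (1 : ℝ))) x v =
      fderiv ℝ (fderiv ℝ P) x v (EuclideanSpace.single i (1 : ℝ)) := fun i => by
    have hd : DifferentiableAt ℝ (fderiv ℝ P) x :=
      ((hP.fderiv_right (m := 1) le_rfl).differentiable one_ne_zero) x
    rw [fderiv_clm_apply hd (differentiableAt_const _)]
    simp
  have hpt : ∀ i, ⟪v, gradient (fun y => kwonCutoff y * fderiv ℝ P y (EuclideanSpace.single i (1 : ℝ))) x⟫ =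
      kwonCutoff x * fderiv ℝ (fderiv ℝ P) x v (EuclideanSpace.single i (1 : ℝ)) +
        fderiv ℝ P x (EuclideanSpace.single i (1 : ℝ)) * ⟪v, gradient kwonCutoff x⟫ := fun i => by
    have hg : gradient (fun y => kwonCutoff y * fderiv ℝ P y (EuclideanSpace.single i (1 : ℝ))) x =
        kwonCutoff x • gradient (fun y => fderiv ℝ P y (EuclideanSpace.single i (1 : ℝ))) x +
          fderiv ℝ P x (EuclideanSpace.single i (1 : ℝ)) • gradient kwonCutoff x := by
      simp only [gradient, fderiv_fun_mul hφd (hψd i), map_add, map_smul]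
    rw [hg, inner_add_right, inner_smul_right, inner_smul_right, ← real_inner_comm v
      (gradient (fun y => fderiv ℝ P y (EuclideanSpace.single i (1 : ℝ))) x), FluidPDE.inner_gradient_left,
      hD2 i]
  simp_rw [hpt, mul_add, Finset.sum_add_distrib]
  have h1 : ∑ i, v i * (kwonCutoff x * fderiv ℝ (fderiv ℝ P) x v (EuclideanSpace.single i (1 : ℝ))) =
      kwonCutoff x * fderiv ℝ (fderiv ℝ P) x v v := by
    rw [clm_apply_self_eq_sum (fderiv ℝ (fderiv ℝ P) x v) v, Finset.mul_sum]
    refine Finset.sum_congr rfl fun i _ => ?_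
    ring
  have h2 : ∑ i, v i * (fderiv ℝ P x (EuclideanSpace.single i (1 : ℝ)) * ⟪v, gradient kwonCutoff x⟫) =
      ⟪v, gradient kwonCutoff x⟫ * ⟪v, gradient P x⟫ := by
    rw [← real_inner_comm v (gradient P x), FluidPDE.inner_gradient_left,
      clm_apply_self_eq_sum (fderiv ℝ P x) v, Finset.mul_sum]
    refine Finset.sum_congr rfl fun i _ => ?_
    ring
  rw [h1, h2, add_comm]

end Algebra

/-! ### (N3) The gradient terms of the duality identity summed over the directions -/

section GradientTerms

variable {U ξ : EuclideanSpace ℝ (Fin 3) → EuclideanSpace ℝ (Fin 3)} {r : ℝ}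

/-- `div A_{∂ₑξ} = ∂ₑ div A_ξ`. [folklore] -/
theorem divergence_testPotential_fderiv_apply (hξ : ContDiff ℝ ∞ ξ) (e x : EuclideanSpace ℝ (Fin 3)) :
    VectorCalculus.divergence (testPotential fun y => fderiv ℝ ξ y e) x =
      fderiv ℝ (VectorCalculus.divergence (testPotential ξ)) x e := by
  rw [← fderiv_testPotential_apply' (contDiff_infty.1 hξ 1) e,
    divergence_fderiv_apply (contDiff_testPotential_nat (contDiff_infty.1 hξ 2)) x e]

/-- A square-integrable field against a bounded field is integrable:
`x ↦ Uᵢ(x) ⟪U(x), G(x)⟫ ∈ L¹` for `G` continuous with compact support. [folklore] -/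
theorem integrable_apply_mul_inner (hUm : AEStronglyMeasurable U volume)
    (hU2 : Integrable fun x => ‖U x‖ ^ 2) {G : EuclideanSpace ℝ (Fin 3) → EuclideanSpace ℝ (Fin 3)}
    (hG : Continuous G) (hGc : HasCompactSupport G) (i : Fin 3) :
    Integrable fun x => U x i * ⟪U x, G x⟫ := by
  obtain ⟨C, hC⟩ := hG.bounded_above_of_compact_support hGc
  have hC0 : 0 ≤ C := (norm_nonneg _).trans (hC 0)
  have hm : AEStronglyMeasurable (fun x => U x i * ⟪U x, G x⟫) volume :=
    ((EuclideanSpace.proj i).continuous.comp_aestronglyMeasurable hUm).mul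
      (hUm.inner hG.aestronglyMeasurable)
  refine Integrable.mono' (hU2.mul_const C) hm (Eventually.of_forall fun x => ?_)
  rw [norm_mul]
  calc ‖U x i‖ * ‖⟪U x, G x⟫‖ ≤ ‖U x‖ * (‖U x‖ * C) :=
        mul_le_mul (by simpa using PiLp.norm_apply_le (p := 2) (U x) i)
          ((norm_inner_le_norm _ _).trans (mul_le_mul_of_nonneg_left (hC x) (norm_nonneg _)))
          (norm_nonneg _) (norm_nonneg _)
    _ = ‖U x‖ ^ 2 * C := by ring

/-- The shell field `(U·∇φ) U` is integrable for `U ∈ L²`. [folklore] -/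
theorem integrable_scalarDensity_smul (hUm : AEStronglyMeasurable U volume)
    (hU2 : Integrable fun x => ‖U x‖ ^ 2) : Integrable fun x => scalarDensity U x • U x := by
  obtain ⟨C, hC0, hC⟩ := exists_bound_gradient_kwonCutoff
  have h1 : AEStronglyMeasurable (scalarDensity U) volume :=
    hUm.inner (𝕜 := ℝ) continuous_gradient_kwonCutoff.aestronglyMeasurable
  have hm : AEStronglyMeasurable (fun x => scalarDensity U x • U x) volume := h1.smul hUm
  refine Integrable.mono' (hU2.mul_const C) hm (Eventually.of_forall fun x => ?_)
  rw [norm_smul, scalarDensity]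
  calc ‖⟪U x, gradient kwonCutoff x⟫‖ * ‖U x‖ ≤ ‖U x‖ * C * ‖U x‖ :=
        mul_le_mul_of_nonneg_right ((norm_inner_le_norm _ _).trans
          (mul_le_mul_of_nonneg_left (hC x) (norm_nonneg _))) (norm_nonneg _)
    _ = ‖U x‖ ^ 2 * C := by ring

/-- **(N3), calculus form**: for `U ∈ L²(ℝ³)` and a compactly supported `P ∈ C³`,
`Σᵢ ∫ Uᵢ ⟪U, ∇(φ ∂ᵢP)⟫ = ∫ ⟪(U·∇φ)U, ∇P⟫ + ∫ φ D²P(U, U)`. [folklore] -/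
theorem sum_integral_apply_mul_inner_gradient_cutoff_mul {P : EuclideanSpace ℝ (Fin 3) → ℝ}
    (hPs : ContDiff ℝ 3 P) (hPc : HasCompactSupport P) (hUm : AEStronglyMeasurable U volume)
    (hU2 : Integrable fun x => ‖U x‖ ^ 2) :
    ∑ i, ∫ x, U x i * ⟪U x, gradient (fun y => kwonCutoff y *
        fderiv ℝ P y (EuclideanSpace.single (i : Fin 3) (1 : ℝ))) x⟫ =
      (∫ x, ⟪scalarDensity U x • U x, gradient P x⟫)
        + ∫ x, kwonCutoff x * fderiv ℝ (fderiv ℝ P) x (U x) (U x) := by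
  have hP2 : ContDiff ℝ 2 P := hPs.of_le (by norm_num)
  -- integrability of the summands
  have hGi : ∀ i : Fin 3, Continuous (gradient fun y => kwonCutoff y *
      fderiv ℝ P y (EuclideanSpace.single i (1 : ℝ))) := fun i =>
    FluidPDE.continuous_gradient_of_contDiff ((contDiff_kwonCutoff (n := 1)).mul
      ((hP2.fderiv_right (m := 1) le_rfl).clm_apply contDiff_const))
  have hGc : ∀ i : Fin 3, HasCompactSupport (gradient fun y => kwonCutoff y *
      fderiv ℝ P y (EuclideanSpace.single i (1 : ℝ))) := fun i =>
    (((hPc.fderiv_apply (𝕜 := ℝ) (EuclideanSpace.single i (1 : ℝ))).mul_left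
      (f := kwonCutoff)).fderiv (𝕜 := ℝ)).comp_left (map_zero _)
  have hint : ∀ i : Fin 3, Integrable fun x => U x i * ⟪U x, gradient (fun y => kwonCutoff y *
      fderiv ℝ P y (EuclideanSpace.single i (1 : ℝ))) x⟫ := fun i =>
    integrable_apply_mul_inner hUm hU2 (hGi i) (hGc i) i
  -- the two pieces are integrable
  have hgP : Continuous (gradient P) := FluidPDE.continuous_gradient_of_contDiff (hP2.of_le one_le_two)
  have hgPc : HasCompactSupport (gradient P) := (hPc.fderiv (𝕜 := ℝ)).comp_left (map_zero _)
  have hd : Integrable fun x => scalarDensity U x • U x := integrable_scalarDensity_smul hUm hU2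
  have hA' : Integrable fun x => ⟪scalarDensity U x • U x, gradient P x⟫ :=
    integrable_inner_density hd hgP hgPc
  have hA : Integrable fun x => ⟪U x, gradient kwonCutoff x⟫ * ⟪U x, gradient P x⟫ := by
    refine hA'.congr (Eventually.of_forall fun x => ?_)
    simp only [scalarDensity, inner_smul_left, RCLike.conj_to_real]
  have hB : Integrable fun x => kwonCutoff x * fderiv ℝ (fderiv ℝ P) x (U x) (U x) := by
    refine ((integrable_finsetSum (Finset.univ : Finset (Fin 3)) fun i _ => hint i).sub hA).congr
      (Eventually.of_forall fun x => ?_)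
    simp only [Pi.sub_apply]
    rw [sum_mul_inner_gradient_cutoff_mul hP2 x (U x)]
    ring
  rw [← integral_finsetSum _ fun i _ => hint i]
  rw [integral_congr_ae (Eventually.of_forall fun x =>
    sum_mul_inner_gradient_cutoff_mul hP2 x (U x)), integral_add hA hB]
  congr 1
  refine integral_congr_ae (Eventually.of_forall fun x => ?_)
  simp only [scalarDensity, inner_smul_left, RCLike.conj_to_real]

/-- **(N3)**: for `U ∈ L²(ℝ³)` and `ξ ∈ C^∞` supported in `B̄(0, r)`, `r < 1`, with `Π = div A_ξ`,
`Σᵢ ∫ Uᵢ ⟪U, ∇(φ div A_{∂ᵢξ})⟫ = ∫ P_{(U·∇φ)U} div ξ + ∫ φ D²Π(U, U)` — the gradient terms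
of the duality identity applied to the convective densities `UᵢU`: a shell pressure plus the
Calderón–Zygmund term `∫ φ U⊗U : ∇²Δ⁻¹div ξ`. [cite: Kwon2023RolePressure, Lemma 2.5 (proof, p. 8)] -/
theorem sum_integral_inner_gradient_cutoff_mul_divergence (hUm : AEStronglyMeasurable U volume)
    (hU2 : Integrable fun x => ‖U x‖ ^ 2) (hξ : ContDiff ℝ ∞ ξ) (hr : r < 1)
    (hsupp : tsupport ξ ⊆ closedBall (0 : EuclideanSpace ℝ (Fin 3)) r) :
    ∑ i, ∫ x, U x i * ⟪U x, gradient (fun y => kwonCutoff y * VectorCalculus.divergence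
        (testPotential fun z => fderiv ℝ ξ z (EuclideanSpace.single (i : Fin 3) (1 : ℝ))) y) x⟫ =
      (∫ y, shellPressure (fun x => scalarDensity U x • U x) y * VectorCalculus.divergence ξ y)
        + ∫ x, kwonCutoff x * fderiv ℝ (fderiv ℝ (VectorCalculus.divergence (testPotential ξ))) x
            (U x) (U x) := by
  have hξc := hasCompactSupport_of_tsupport_subset_closedBall hsupp
  have hPs : ContDiff ℝ 3 (VectorCalculus.divergence (testPotential ξ)) :=
    contDiff_divergence_testPotential hξ hξc
  have hPc : HasCompactSupport (VectorCalculus.divergence (testPotential ξ)) :=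
    hasCompactSupport_divergence_testPotential hξc
  have hdiv : ∀ i : Fin 3, (fun y => kwonCutoff y * VectorCalculus.divergence
      (testPotential fun z => fderiv ℝ ξ z (EuclideanSpace.single i (1 : ℝ))) y) =
      fun y => kwonCutoff y * fderiv ℝ (VectorCalculus.divergence (testPotential ξ)) y
        (EuclideanSpace.single i (1 : ℝ)) := fun i => by
    funext y; rw [divergence_testPotential_fderiv_apply hξ _ y]
  simp_rw [hdiv]
  rw [sum_integral_apply_mul_inner_gradient_cutoff_mul hPs hPc hUm hU2,
    integral_inner_gradient_divergence_testPotential (integrable_scalarDensity_smul hUm hU2)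
      (fun x hx => ?_) hξ hr hsupp]
  rcases hx with hx | hx
  · rw [scalarDensity_eq_zero_of_lt hx, zero_smul]
  · rw [scalarDensity_eq_zero_of_gt hx, zero_smul]

end GradientTerms

/-! ### (hh) The self-interaction of the harmonic part: local Helmholtz splitting -/

section SelfInteraction

variable {U ξ : EuclideanSpace ℝ (Fin 3) → EuclideanSpace ℝ (Fin 3)}

/-- Kwon's inner cut-off `φ♭ = θ_{1, 9/8}`: `φ♭ = 1` on `B̄₁`, `supp φ♭ ⊂ B_{9/8} ⊂ {φ = 1}`
(Kwon 2023, proof of Lemma 2.5: "`φ♭ = 1` on `B₁` … `supp(φ♭) ⊂ {φ = 1}`"). [cite: Kwon2023RolePressure, Lemma 2.5 (proof, p. 8)] -/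
def kwonFlatCutoff : EuclideanSpace ℝ (Fin 3) → ℝ := radialCutoff 1 (9 / 8)

/-- `φ♭` is smooth. [folklore] -/
theorem contDiff_kwonFlatCutoff {n : ℕ∞} : ContDiff ℝ n kwonFlatCutoff :=
  radialCutoff_contDiff (E' := EuclideanSpace ℝ (Fin 3)) _ _

/-- `φ♭` has compact support. [folklore] -/
theorem hasCompactSupport_kwonFlatCutoff : HasCompactSupport kwonFlatCutoff :=
  hasCompactSupport_radialCutoff (E := EuclideanSpace ℝ (Fin 3)) zero_le_one (by norm_num)

/-- `φ♭ = 1` on `B̄₁`. [folklore] -/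
theorem kwonFlatCutoff_eq_one {x : EuclideanSpace ℝ (Fin 3)} (hx : ‖x‖ ≤ 1) : kwonFlatCutoff x = 1 :=
  radialCutoff_eq_one zero_le_one (by norm_num) hx

variable (U) in
/-- **The cut-off self-stretching of the harmonic part**, `F = φ♭ (h·∇)h`
(Kwon's `curl h × h φ♭`, up to the gradient `∇(|h|²/2)φ♭` absorbed in his `q`): smooth and
compactly supported. [cite: Kwon2023RolePressure, Lemma 2.5 (proof, p. 8)] -/
def selfStretch (x : EuclideanSpace ℝ (Fin 3)) : EuclideanSpace ℝ (Fin 3) :=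
  kwonFlatCutoff x • fderiv ℝ (harmonicPart U) x (harmonicPart U x)

/-- `F` is smooth. [folklore] -/
theorem contDiff_selfStretch (hU : IntegrableOn U (ball (0 : EuclideanSpace ℝ (Fin 3)) 2)) {n : ℕ∞} :
    ContDiff ℝ n (selfStretch U) := by
  have hh : ContDiff ℝ (n + 1) (harmonicPart U) :=
    contDiff_harmonicPart (integrable_scalarDensity hU).locallyIntegrable
      (integrable_vectorDensity hU).locallyIntegrable
  exact contDiff_kwonFlatCutoff.smul ((hh.fderiv_right (m := n) le_rfl).clm_apply (hh.of_le le_self_add))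

/-- `F` has compact support. [folklore] -/
theorem hasCompactSupport_selfStretch : HasCompactSupport (selfStretch U) :=
  hasCompactSupport_kwonFlatCutoff.smul_right

/-- **`∫ ⟪h, (h·∇)ξ⟫ = ∫ π[F] div ξ − ∫ ⟪P[F], ξ⟫`** for `ξ ∈ C^∞` supported in `B₁`: the
self-interaction of the harmonic part is a pressure plus a smooth divergence-free force
(`(h·∇)` moved onto `h` using `div h = 0` on `B₁`, `(h·∇)h = F` on `supp ξ`, and the classical
Helmholtz–Leray decomposition `F = P[F] + ∇π[F]` of the test field `F`; Kwon's
`curl h × h φ♭ = −curl Δ⁻¹ curl(·) + ∇Δ⁻¹ div(·)`). [cite: Kwon2023RolePressure, Lemma 2.5 (proof, p. 8)] -/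
theorem integral_inner_harmonicPart_convect (hU : IntegrableOn U (ball (0 : EuclideanSpace ℝ (Fin 3)) 2))
    (hξ : ContDiff ℝ ∞ ξ) (hsupp : tsupport ξ ⊆ ball (0 : EuclideanSpace ℝ (Fin 3)) 1) :
    ∫ x, ⟪harmonicPart U x, fderiv ℝ ξ x (harmonicPart U x)⟫ =
      (∫ y, divPotential (selfStretch U) y * VectorCalculus.divergence ξ y)
        - ∫ y, ⟪classicalLerayProj (selfStretch U) y, ξ y⟫ := by
  have hξc : HasCompactSupport ξ :=
    HasCompactSupport.of_support_subset_isCompact (isCompact_closedBall 0 1)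
      ((subset_tsupport ξ).trans (hsupp.trans ball_subset_closedBall))
  have hξ1 : ContDiff ℝ 1 ξ := contDiff_infty.1 hξ 1
  have h₁ := (integrable_scalarDensity hU).locallyIntegrable
  have h₂ := (integrable_vectorDensity hU).locallyIntegrable
  have hh1 : ContDiff ℝ 1 (harmonicPart U) := contDiff_harmonicPart h₁ h₂
  have hF : ContDiff ℝ ∞ (selfStretch U) := contDiff_selfStretch hU
  have hFc : HasCompactSupport (selfStretch U) := hasCompactSupport_selfStretch
  -- (1) move the derivative: `∫ ⟪h, (h·∇)ξ⟫ = -∫ ⟪(h·∇)h, ξ⟫`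
  have hibp := integral_inner_convect_add_eq_zero hh1 hh1 hξ1 hξc
  have hdiv0 : ∫ x, VectorCalculus.divergence (harmonicPart U) x *
      ⟪harmonicPart U x, ξ x⟫ = 0 := by
    refine integral_eq_zero_of_ae (Eventually.of_forall fun x => ?_)
    show VectorCalculus.divergence (harmonicPart U) x * ⟪harmonicPart U x, ξ x⟫ = 0
    by_cases hx : x ∈ tsupport ξ
    · rw [divergence_harmonicPart_eq_zero h₁ h₂ (mem_ball_zero_iff.1 (hsupp hx)), zero_mul]
    · rw [image_eq_zero_of_notMem_tsupport hx, inner_zero_right, mul_zero]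
  rw [hdiv0, add_zero] at hibp
  have e1 : ∫ x, ⟪harmonicPart U x, fderiv ℝ ξ x (harmonicPart U x)⟫ =
      -∫ x, ⟪selfStretch U x, ξ x⟫ := by
    have e : ∫ x, ⟪convect (harmonicPart U) (harmonicPart U) x, ξ x⟫ =
        ∫ x, ⟪selfStretch U x, ξ x⟫ := by
      refine integral_congr_ae (Eventually.of_forall fun x => ?_)
      by_cases hx : x ∈ tsupport ξ
      · simp only [selfStretch, convect, kwonFlatCutoff_eq_one (mem_ball_zero_iff.1 (hsupp hx)).le,
          one_smul]
      · simp [image_eq_zero_of_notMem_tsupport hx]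
    have : ∫ x, ⟪harmonicPart U x, convect (harmonicPart U) ξ x⟫ =
        ∫ x, ⟪harmonicPart U x, fderiv ℝ ξ x (harmonicPart U x)⟫ := rfl
    linarith
  -- (2) Helmholtz–Leray: `F = P[F] + ∇π[F]`
  have hPc : Continuous (classicalLerayProj (selfStretch U)) :=
    (contDiff_classicalLerayProj hF hFc).continuous
  have hπ1 : ContDiff ℝ 1 (divPotential (selfStretch U)) :=
    (contDiff_divPotential hF hFc).of_le (by exact_mod_cast le_top)
  have hi1 : Integrable fun x => ⟪classicalLerayProj (selfStretch U) x, ξ x⟫ :=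
    (hPc.inner (𝕜 := ℝ) hξ.continuous).integrable_of_hasCompactSupport
      (hξc.mono support_inner_subset_right)
  have hi2 : Integrable fun x => ⟪gradient (divPotential (selfStretch U)) x, ξ x⟫ :=
    ((FluidPDE.continuous_gradient_of_contDiff hπ1).inner (𝕜 := ℝ) hξ.continuous)
      |>.integrable_of_hasCompactSupport (hξc.mono support_inner_subset_right)
  have e2 : ∫ x, ⟪selfStretch U x, ξ x⟫ =
      (∫ x, ⟪classicalLerayProj (selfStretch U) x, ξ x⟫)
        - ∫ y, divPotential (selfStretch U) y * VectorCalculus.divergence ξ y := by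
    rw [sub_eq_add_neg, ← integral_inner_gradient_eq_neg_integral_mul_divergence hπ1 hξ1 hξc,
      ← integral_add hi1 hi2]
    refine integral_congr_ae (Eventually.of_forall fun x => ?_)
    show ⟪selfStretch U x, ξ x⟫ = ⟪classicalLerayProj (selfStretch U) x, ξ x⟫ +
      ⟪gradient (divPotential (selfStretch U)) x, ξ x⟫
    rw [← inner_add_left, classicalLerayProj_add_gradient]
  rw [e1, e2]
  ring

end SelfInteraction

end Kwon2023

end Literature.Analysis.FluidPDE

end
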